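import Summits.KontsevichZagierPeriods.KontsevichZagierPeriods.Theorems.GenusTwoCycleTransfer.Negative.Witnesses

/-!
# `GenusTwoCycleTransfer` (stmt-KontsevichZagierPeriods-3408) — negative knowledge, part 3a: model integrals and pointwise bounds on the quintic

Support file for the crux `HermiteRigidity.GenusTwoCycleTransfer` (cdisprove seat, cycle 1; work
file `Cruxes/GenusTwoCycleTransfer/Disproof.lean`). Elementary inputs for the period enclosures of
part 3b (`OvalOrder`): the model integral `∫ᵤᵛ dx/√((x−a)(a+1−x)) = arcsin(2v−2a−1) − arcsin(2u−2a−1)`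
(`a ≤ u ≤ v ≤ a+1`), `∫₅⁶ dx/√(x−5) = 2`, the tail `∫₆^∞ x^{-5/2} ≤ (2/3)(1/14)`, and two-sided
polynomial bounds for `f = x(x−1)(x−2)(x−3)(x−5)` on the pieces `(0,½]`, `[½,1)`, `(0,1)`,
`(2,5/2]`, `[5/2,3)`, `(2,3)`, `(5,6]`, `[6,∞)` (cofactor estimates; the cofactor `x(x−1)(5−x)` is
handled through the exact factorizations `75/8 − x(x−1)(5−x) = (5/2−x)(15/4 + x(7/2−x))` and
`12 − x(x−1)(5−x) = (3−x)(4−x)(x+1)`). [folklore]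
-/

noncomputable section

open Set MeasureTheory MvPolynomial Real
open Literature.NumberTheory.Transcendental Literature.ModelTheory.ExponentialFields

namespace Summit.KontsevichZagierPeriods.HermiteRigidity.GenusTwoCycleTransferNegative


/-! ### §1 Model integrals -/

/-- `∫ᵤᵛ dx/√((x−a)(a+1−x)) = arcsin(2v−2a−1) − arcsin(2u−2a−1)` for `a ≤ u ≤ v ≤ a+1`, together
with integrability on `(u,v]` (the primitive `arcsin(2x−2a−1)` is continuous on the closed
interval; `intervalIntegral.integrableOn_deriv_of_nonneg`). [folklore] -/
theorem integral_model_arcsin (a u v : ℝ) (hu : a ≤ u) (huv : u ≤ v) (hv : v ≤ a + 1) :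
    (∫ x in u..v, 1 / Real.sqrt ((x - a) * (a + 1 - x))) =
      Real.arcsin (2 * v - 2 * a - 1) - Real.arcsin (2 * u - 2 * a - 1) ∧
    IntegrableOn (fun x => 1 / Real.sqrt ((x - a) * (a + 1 - x))) (Ioc u v) := by
  have hderiv : ∀ x ∈ Ioo u v, HasDerivAt (fun y => Real.arcsin (2 * y - 2 * a - 1))
      (1 / Real.sqrt ((x - a) * (a + 1 - x))) x := by
    intro x hx
    have hxa : a < x := lt_of_le_of_lt hu hx.1
    have hxb : x < a + 1 := lt_of_lt_of_le hx.2 hv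
    have h1 : 2 * x - 2 * a - 1 ≠ -1 := by intro h; linarith
    have h2 : 2 * x - 2 * a - 1 ≠ 1 := by intro h; linarith
    have haff : HasDerivAt (fun y : ℝ => 2 * y - 2 * a - 1) 2 x := by
      have h := ((hasDerivAt_id x).const_mul 2).sub_const (2 * a + 1)
      simp only [id, mul_one] at h
      exact h.congr_of_eventuallyEq (Filter.Eventually.of_forall fun y => by simp only; ring)
    have hc := (Real.hasDerivAt_arcsin h1 h2).comp x haff
    refine hc.congr_deriv ?_
    have hq : 1 - (2 * x - 2 * a - 1) ^ 2 = 4 * ((x - a) * (a + 1 - x)) := by ring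
    rw [hq, Real.sqrt_mul (by norm_num : (0:ℝ) ≤ 4), show Real.sqrt 4 = 2 by
      rw [show (4:ℝ) = 2 ^ 2 by norm_num, Real.sqrt_sq (by norm_num)]]
    have hpos : 0 < Real.sqrt ((x - a) * (a + 1 - x)) :=
      Real.sqrt_pos.mpr (mul_pos (by linarith) (by linarith))
    field_simp
  have hcont : ContinuousOn (fun y => Real.arcsin (2 * y - 2 * a - 1)) (Icc u v) :=
    (Real.continuous_arcsin.comp (by fun_prop)).continuousOn
  have hint : IntegrableOn (fun x => 1 / Real.sqrt ((x - a) * (a + 1 - x))) (Ioc u v) :=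
    intervalIntegral.integrableOn_deriv_of_nonneg hcont hderiv (fun x _ => by positivity)
  exact ⟨intervalIntegral.integral_eq_sub_of_hasDerivAt_of_le huv hcont hderiv
    ((intervalIntegrable_iff_integrableOn_Ioc_of_le huv).mpr hint), hint⟩

/-- `∫₅⁶ dx/√(x−5) = 2`, with integrability on `(5,6]`. [folklore] -/
theorem integral_inv_sqrt_sub_five : (∫ x in (5:ℝ)..6, (Real.sqrt (x - 5))⁻¹) = 2 ∧
    IntegrableOn (fun x => (Real.sqrt (x - 5))⁻¹) (Ioc (5:ℝ) 6) := by
  have hderiv : ∀ x ∈ Ioo (5:ℝ) 6, HasDerivAt (fun y => 2 * Real.sqrt (y - 5))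
      ((Real.sqrt (x - 5))⁻¹) x := by
    intro x hx
    have hx0 : x - 5 ≠ 0 := (sub_pos.2 hx.1).ne'
    have hs : Real.sqrt (x - 5) ≠ 0 := Real.sqrt_ne_zero'.2 (sub_pos.2 hx.1)
    refine ((((hasDerivAt_id x).sub_const 5).sqrt hx0).const_mul 2).congr_deriv ?_
    simp only [id]
    field_simp
  have hcont : ContinuousOn (fun y => 2 * Real.sqrt (y - 5)) (Icc (5:ℝ) 6) := by fun_prop
  have hint : IntegrableOn (fun x => (Real.sqrt (x - 5))⁻¹) (Ioc (5:ℝ) 6) :=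
    intervalIntegral.integrableOn_deriv_of_nonneg hcont hderiv (fun x _ => by positivity)
  refine ⟨?_, hint⟩
  rw [intervalIntegral.integral_eq_sub_of_hasDerivAt_of_le (by norm_num) hcont hderiv
    ((intervalIntegrable_iff_integrableOn_Ioc_of_le (by norm_num)).mpr hint)]
  norm_num

/-- The tail integral: `∫₆^∞ x^{-5/2} dx = (2/3)·6^{-3/2} ≤ (2/3)(1/14)` (`6^{3/2} ≥ 14` since
`216 ≥ 196`). [folklore] -/
theorem integral_tail_le : (∫ x in Ioi (6:ℝ), x ^ (-(5/2) : ℝ)) ≤ 2 / 3 * (1 / 14) := by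
  rw [integral_Ioi_rpow_of_lt (by norm_num) (by norm_num)]
  have h6 : (14:ℝ) ≤ (6:ℝ) ^ ((3:ℝ) / 2) := by
    have : ((6:ℝ) ^ ((3:ℝ) / 2)) ^ 2 = 216 := by
      rw [← Real.rpow_natCast, ← Real.rpow_mul (by norm_num)]; norm_num
    nlinarith [Real.rpow_nonneg (show (0:ℝ) ≤ 6 by norm_num) ((3:ℝ)/2)]
  have e : (6:ℝ) ^ (-(5/2 : ℝ) + 1) = ((6:ℝ) ^ ((3:ℝ)/2))⁻¹ := by
    rw [← Real.rpow_neg (by norm_num)]; norm_num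
  rw [e]
  have hpos : (0:ℝ) < (6:ℝ) ^ ((3:ℝ)/2) := by positivity
  rw [show -((6:ℝ) ^ ((3:ℝ) / 2))⁻¹ / (-(5 / 2) + 1) = 2 / 3 * ((6:ℝ) ^ ((3:ℝ) / 2))⁻¹ by ring]
  gcongr
  rw [inv_le_comm₀ hpos (by norm_num)]
  simpa using h6

/-! ### §2 Pointwise bounds on the quintic -/

/-- On `(0,½]`: `(135/8)·x(1−x) ≤ f(x)` (cofactor factors `≥ 3/2, 5/2, 9/2`). [folklore] -/
theorem quintic_ge_left01 {x : ℝ} (hx : x ∈ Ioc (0:ℝ) (1/2)) :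
    135 / 8 * ((x - 0) * (0 + 1 - x)) ≤ x * (x - 1) * (x - 2) * (x - 3) * (x - 5) := by
  have hg : (135:ℝ) / 8 ≤ (2 - x) * (3 - x) * (5 - x) := by
    have h1 : (3:ℝ)/2 ≤ 2 - x := by linarith [hx.2]
    have h2 : (5:ℝ)/2 ≤ 3 - x := by linarith [hx.2]
    have h3 : (9:ℝ)/2 ≤ 5 - x := by linarith [hx.2]
    calc (135:ℝ) / 8 = 3 / 2 * (5 / 2) * (9 / 2) := by norm_num
      _ ≤ (2 - x) * (3 - x) * (5 - x) := by gcongr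
  have h0 : 0 ≤ x * (1 - x) := mul_nonneg hx.1.le (by linarith [hx.2])
  calc 135 / 8 * ((x - 0) * (0 + 1 - x)) = x * (1 - x) * (135 / 8) := by ring
    _ ≤ x * (1 - x) * ((2 - x) * (3 - x) * (5 - x)) := mul_le_mul_of_nonneg_left hg h0
    _ = x * (x - 1) * (x - 2) * (x - 3) * (x - 5) := by ring

/-- On `[½,1)`: `8·x(1−x) ≤ f(x)` (cofactor factors `≥ 1, 2, 4`). [folklore] -/
theorem quintic_ge_right01 {x : ℝ} (hx : x ∈ Ioo (1/2 : ℝ) 1) :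
    8 * ((x - 0) * (0 + 1 - x)) ≤ x * (x - 1) * (x - 2) * (x - 3) * (x - 5) := by
  have hg : (8:ℝ) ≤ (2 - x) * (3 - x) * (5 - x) := by
    have h1 : (1:ℝ) ≤ 2 - x := by linarith [hx.2]
    have h2 : (2:ℝ) ≤ 3 - x := by linarith [hx.2]
    have h3 : (4:ℝ) ≤ 5 - x := by linarith [hx.2]
    calc (8:ℝ) = 1 * 2 * 4 := by norm_num
      _ ≤ (2 - x) * (3 - x) * (5 - x) := by gcongr
  have h0 : 0 ≤ x * (1 - x) := mul_nonneg (by linarith [hx.1]) (by linarith [hx.2])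
  calc 8 * ((x - 0) * (0 + 1 - x)) = x * (1 - x) * 8 := by ring
    _ ≤ x * (1 - x) * ((2 - x) * (3 - x) * (5 - x)) := mul_le_mul_of_nonneg_left hg h0
    _ = x * (x - 1) * (x - 2) * (x - 3) * (x - 5) := by ring

/-- On `(0,1)`: `f(x) ≤ 30·x(1−x)` (cofactor factors `≤ 2, 3, 5`). [folklore] -/
theorem quintic_le_01 {x : ℝ} (hx : x ∈ Ioo (0:ℝ) 1) :
    x * (x - 1) * (x - 2) * (x - 3) * (x - 5) ≤ 30 * ((x - 0) * (0 + 1 - x)) := by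
  have hg : (2 - x) * (3 - x) * (5 - x) ≤ 30 := by
    have h1 : 2 - x ≤ (2:ℝ) := by linarith [hx.1]
    have h2 : 3 - x ≤ (3:ℝ) := by linarith [hx.1]
    have h3 : 5 - x ≤ (5:ℝ) := by linarith [hx.1]
    have p1 : (0:ℝ) ≤ 2 - x := by linarith [hx.2]
    have p2 : (0:ℝ) ≤ 3 - x := by linarith [hx.2]
    have p3 : (0:ℝ) ≤ 5 - x := by linarith [hx.2]
    calc (2 - x) * (3 - x) * (5 - x) ≤ 2 * 3 * 5 := by gcongr
      _ = 30 := by norm_num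
  have h0 : 0 ≤ x * (1 - x) := mul_nonneg hx.1.le (by linarith [hx.2])
  calc x * (x - 1) * (x - 2) * (x - 3) * (x - 5) = x * (1 - x) * ((2 - x) * (3 - x) * (5 - x)) := by
        ring
    _ ≤ x * (1 - x) * 30 := mul_le_mul_of_nonneg_left hg h0
    _ = 30 * ((x - 0) * (0 + 1 - x)) := by ring

/-- On `(2,5/2]`: `f(x) ≤ (75/8)(x−2)(3−x)` (the cofactor `x(x−1)(5−x)` is increasing on `[2,3]`,
`75/8 − x(x−1)(5−x) = (5/2 − x)(15/4 + x(7/2 − x)) ≥ 0`). [folklore] -/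
theorem quintic_le_left23 {x : ℝ} (hx : x ∈ Ioc (2:ℝ) (5/2)) :
    x * (x - 1) * (x - 2) * (x - 3) * (x - 5) ≤ 75 / 8 * ((x - 2) * (2 + 1 - x)) := by
  have hg : x * (x - 1) * (5 - x) ≤ 75 / 8 := by
    have e : x * (x - 1) * (5 - x) = 75 / 8 - (5 / 2 - x) * (15 / 4 + x * (7 / 2 - x)) := by ring
    rw [e]
    have : 0 ≤ (5 / 2 - x) * (15 / 4 + x * (7 / 2 - x)) :=
      mul_nonneg (by linarith [hx.2]) (by nlinarith [hx.1, hx.2])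
    linarith
  have h0 : 0 ≤ (x - 2) * (3 - x) := mul_nonneg (by linarith [hx.1]) (by linarith [hx.2])
  calc x * (x - 1) * (x - 2) * (x - 3) * (x - 5) = (x - 2) * (3 - x) * (x * (x - 1) * (5 - x)) := by
        ring
    _ ≤ (x - 2) * (3 - x) * (75 / 8) := mul_le_mul_of_nonneg_left hg h0
    _ = 75 / 8 * ((x - 2) * (2 + 1 - x)) := by ring

/-- On `[2,3)`: `x(x−1)(5−x) ≤ 12` (`12 − x(x−1)(5−x) = (3−x)(4−x)(x+1) ≥ 0`). [folklore] -/
theorem cofactor_le_twelve {x : ℝ} (hx2 : 2 ≤ x) (hx3 : x ≤ 3) : x * (x - 1) * (5 - x) ≤ 12 := by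
  have e : x * (x - 1) * (5 - x) = 12 - (3 - x) * (4 - x) * (x + 1) := by ring
  rw [e]
  have : 0 ≤ (3 - x) * (4 - x) * (x + 1) :=
    mul_nonneg (mul_nonneg (by linarith) (by linarith)) (by linarith)
  linarith

/-- On `[5/2,3)`: `f(x) ≤ 12(x−2)(3−x)`. [folklore] -/
theorem quintic_le_right23 {x : ℝ} (hx : x ∈ Ioo (5/2 : ℝ) 3) :
    x * (x - 1) * (x - 2) * (x - 3) * (x - 5) ≤ 12 * ((x - 2) * (2 + 1 - x)) := by
  have hg := cofactor_le_twelve (by linarith [hx.1]) hx.2.le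
  have h0 : 0 ≤ (x - 2) * (3 - x) := mul_nonneg (by linarith [hx.1]) (by linarith [hx.2])
  calc x * (x - 1) * (x - 2) * (x - 3) * (x - 5) = (x - 2) * (3 - x) * (x * (x - 1) * (5 - x)) := by
        ring
    _ ≤ (x - 2) * (3 - x) * 12 := mul_le_mul_of_nonneg_left hg h0
    _ = 12 * ((x - 2) * (2 + 1 - x)) := by ring

/-- On `(2,3)`: `f(x) ≤ 3` (`(x−2)(3−x) ≤ 1/4` and the cofactor is `≤ 12`). [folklore] -/
theorem quintic_le_three {x : ℝ} (hx : x ∈ Ioo (2:ℝ) 3) :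
    x * (x - 1) * (x - 2) * (x - 3) * (x - 5) ≤ 3 := by
  have hg := cofactor_le_twelve hx.1.le hx.2.le
  have h0 : 0 ≤ (x - 2) * (3 - x) := mul_nonneg (by linarith [hx.1]) (by linarith [hx.2])
  have hq : (x - 2) * (3 - x) ≤ 1 / 4 := by nlinarith [sq_nonneg (x - 5 / 2)]
  have hc0 : 0 ≤ x * (x - 1) * (5 - x) :=
    mul_nonneg (mul_nonneg (by linarith [hx.1]) (by linarith [hx.1])) (by linarith [hx.2])
  calc x * (x - 1) * (x - 2) * (x - 3) * (x - 5) = (x - 2) * (3 - x) * (x * (x - 1) * (5 - x)) := by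
        ring
    _ ≤ 1 / 4 * 12 := mul_le_mul hq hg hc0 (by norm_num)
    _ = 3 := by norm_num

/-- On `(5,6]`: `120(x−5) ≤ f(x)`. [folklore] -/
theorem quintic_ge_56 {x : ℝ} (hx : x ∈ Ioc (5:ℝ) 6) :
    120 * (x - 5) ≤ x * (x - 1) * (x - 2) * (x - 3) * (x - 5) := by
  have hg : (120:ℝ) ≤ x * (x - 1) * (x - 2) * (x - 3) := by
    have h1 : (5:ℝ) ≤ x := hx.1.le
    have h2 : (4:ℝ) ≤ x - 1 := by linarith [hx.1]
    have h3 : (3:ℝ) ≤ x - 2 := by linarith [hx.1]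
    have h4 : (2:ℝ) ≤ x - 3 := by linarith [hx.1]
    calc (120:ℝ) = 5 * 4 * 3 * 2 := by norm_num
      _ ≤ x * (x - 1) * (x - 2) * (x - 3) := by gcongr
  have h0 : 0 ≤ x - 5 := by linarith [hx.1]
  calc 120 * (x - 5) = (x - 5) * 120 := by ring
    _ ≤ (x - 5) * (x * (x - 1) * (x - 2) * (x - 3)) := mul_le_mul_of_nonneg_left hg h0
    _ = x * (x - 1) * (x - 2) * (x - 3) * (x - 5) := by ring

/-- On `(6,∞)`: `x⁵/25 ≤ f(x)`, written with `y = x^{5/2}`: `(y/5)² ≤ f(x)`. [folklore] -/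
theorem quintic_ge_tail {x : ℝ} (hx : x ∈ Ioi (6:ℝ)) :
    (x ^ ((5:ℝ) / 2) / 5) ^ 2 ≤ x * (x - 1) * (x - 2) * (x - 3) * (x - 5) := by
  have hx6 : 6 < x := hx
  have hx0 : 0 < x := by linarith
  have hy : (x ^ ((5:ℝ) / 2)) ^ 2 = x ^ 5 := by
    rw [← Real.rpow_natCast, ← Real.rpow_mul hx0.le]; norm_num
  rw [div_pow, hy]
  -- x⁵ ≤ 25 f : each factor x - k ≥ (1 - k/6) x
  have h1 : 5 / 6 * x ≤ x - 1 := by linarith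
  have h2 : 4 / 6 * x ≤ x - 2 := by linarith
  have h3 : 3 / 6 * x ≤ x - 3 := by linarith
  have h5 : 1 / 6 * x ≤ x - 5 := by linarith
  have n1 : 0 ≤ x - 1 := by linarith
  have n2 : 0 ≤ x - 2 := by linarith
  have n3 : 0 ≤ x - 3 := by linarith
  have key : x * (5 / 6 * x) * (4 / 6 * x) * (3 / 6 * x) * (1 / 6 * x) ≤
      x * (x - 1) * (x - 2) * (x - 3) * (x - 5) := by
    gcongr
  have : x ^ 5 / 5 ^ 2 ≤ x * (5 / 6 * x) * (4 / 6 * x) * (3 / 6 * x) * (1 / 6 * x) := by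
    have : x * (5 / 6 * x) * (4 / 6 * x) * (3 / 6 * x) * (1 / 6 * x) = (60 / 1296) * x ^ 5 := by ring
    rw [this]
    nlinarith [pow_pos hx0 5]
  linarith

end Summit.KontsevichZagierPeriods.HermiteRigidity.GenusTwoCycleTransferNegative

end
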